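import Literature.Probability.LatticeModels.LoopO1
import Literature.Probability.LatticeModels.ModifiedSimonInequality
import Literature.Combinatorics.SimpleGraph.CycleSpaceSeparators
import HarnessLib

/-!
# Crux IndependentStrandsJoin (stmt-CriticalPhenomena-14625) — the union-shadow fibre decomposition

Route `FKParityRobustness`, sub-problem `Ising3DConformalLimit`; helper file (registered aux stub
`stub_unionShadowFibre`) for the registered stub `stub_unionShadowIdentity` of the line `union-shadow-exact`
(the exact loop-O(1) form of the Aizenman–Duminil-Copin deletion identity, landed in
`Theorems/FKParityRobustnessIndependentStrandsJoinStubUnionShadowIdentity.lean`).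

THE FIBRE DECOMPOSITION relative to a fixed base edge set `B` (the other configuration) and a root `x`: for an
edge set `F` let `C_F = {v : x ↝_{B ∪ F} v}` and split `F = in(F) ⊔ out(F)`, `in(F)` = the edges of `F` with an
endpoint in `C_F` (then all endpoints are in `C_F`, `inF_closed`), `out(F) = F ∖ in(F)` the edges off `C_F`.
Then `C_{in(F)} = C_F` (`reach_inF_iff`, a walk induction); if `F ∈ 𝒯(A)` and a set `S ⊇ A` lies off `C_F`,
`in(F)` is an EVEN subgraph glued to its own cluster with `S` off it (`inF_mem_idx`) and `out(F)` is a `T`-join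
of `A` among the edges avoiding `C_F` (`sdiff_mem_out`); conversely `I ⊔ O` with `O` avoiding `C_I` has
`C_{I ∪ O} = C_I` (`reach_union_iff`), lies in `𝒯(A)` and has `in(I ∪ O) = I` (`union_mem_fibre`).  Hence the
FIBRE IDENTITY (`fibre_identity` = `stub_unionShadowFibre`): for `A ⊆ S`,
`Σ_{F ∈ 𝒯(A), S off C_F} g(F) = Σ_{I ∈ Idx(S)} Σ_{O ∈ 𝒯_{off C_I}(A)} g(I ∪ O)` with the SAME index set
`Idx(S) = {I ∈ 𝒯(∅) : in(I) = I, S off C_I}` for every source set `A` — the bookkeeping behind every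
"delete the cluster of the other configuration" identity (ADC2021 App. A; the tree's `DepletionBound.fibre_sum`
is the base-free case `B = ∅`).

References: M. Aizenman, H. Duminil-Copin, Ann. of Math. 194 (2021), arXiv:1912.07973, App. A
[AizenmanDuminilCopinAnnals2021]; U. T. Hansen, J. Jiang, F. R. Klausen, arXiv:2506.10765 §2 (sourced loop O(1),
`T`-joins) [HansenJiangKlausen2025].  Theorem-only file; helpers in the sub-namespace `StubUnionShadowIdentity`.
-/

noncomputable section

open Finset SimpleGraph
open Literature.Probability.LatticeModels
open Literature.Combinatorics.SimpleGraph.CycleSpace (edgeDeg exists_reachable_odd_of_odd)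

namespace Summit.CriticalPhenomena.Ising3DConformalLimit.Theorems

open scoped Classical BigOperators

namespace StubUnionShadowIdentity

variable {V : Type*} [Fintype V] [DecidableEq V]

/-! ### Reachability inside `B ∪ F` from a fixed root -/

omit [Fintype V] [DecidableEq V] in
/-- Monotonicity of reachability in the variable edge set (base `B` fixed). -/
theorem reach_mono {B F F' : Finset (Sym2 V)} (h : F ⊆ F') {x v : V}
    (hr : (fromEdgeSet ((↑B : Set (Sym2 V)) ∪ ↑F)).Reachable x v) :
    (fromEdgeSet ((↑B : Set (Sym2 V)) ∪ ↑F')).Reachable x v :=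
  hr.mono (fromEdgeSet_mono (Set.union_subset_union_right _ (Finset.coe_subset.2 h)))

omit [Fintype V] in
/-- One step along an edge of `B ∪ F`: if one endpoint is reachable, so is the other. -/
theorem reach_step {B F : Finset (Sym2 V)} {x u v : V} {e : Sym2 V} (he : e ∈ B ∨ e ∈ F)
    (hu : u ∈ e) (hv : v ∈ e) (hr : (fromEdgeSet ((↑B : Set (Sym2 V)) ∪ ↑F)).Reachable x u) :
    (fromEdgeSet ((↑B : Set (Sym2 V)) ∪ ↑F)).Reachable x v := by
  by_cases huv : u = v
  · exact huv ▸ hr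
  · have heq : e = s(u, v) := (Sym2.mem_and_mem_iff huv).1 ⟨hu, hv⟩
    refine hr.trans (Adj.reachable ?_)
    rw [fromEdgeSet_adj]
    refine ⟨?_, huv⟩
    rw [← heq]
    rcases he with h | h
    · exact Or.inl (Finset.mem_coe.2 h)
    · exact Or.inr (Finset.mem_coe.2 h)

/-- Along a walk in `B ∪ F` starting from a vertex reachable inside `B ∪ in(F)`, every vertex is reachable
inside `B ∪ in(F)`, where `in(F)` = the edges of `F` with an endpoint reachable inside `B ∪ F`. -/
theorem reach_inF_walk {B F : Finset (Sym2 V)} {x : V} :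
    ∀ {u v : V} (_ : (fromEdgeSet ((↑B : Set (Sym2 V)) ∪ ↑F)).Walk u v),
      (fromEdgeSet ((↑B : Set (Sym2 V)) ∪ ↑(F.filter fun e => ∃ w ∈ e,
          (fromEdgeSet ((↑B : Set (Sym2 V)) ∪ ↑F)).Reachable x w))).Reachable x u →
      (fromEdgeSet ((↑B : Set (Sym2 V)) ∪ ↑(F.filter fun e => ∃ w ∈ e,
          (fromEdgeSet ((↑B : Set (Sym2 V)) ∪ ↑F)).Reachable x w))).Reachable x v := by
  intro u v p
  induction p with
  | nil => exact id
  | @cons u w _ hadj _ ih =>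
    intro hu
    refine ih (hu.trans (Adj.reachable ?_))
    obtain ⟨hmem, hne⟩ := (fromEdgeSet_adj _).1 hadj
    rw [fromEdgeSet_adj]
    refine ⟨?_, hne⟩
    rcases hmem with h | h
    · exact Or.inl h
    · refine Or.inr (Finset.mem_coe.2 (Finset.mem_filter.2 ⟨Finset.mem_coe.1 h, u, Sym2.mem_mk_left u w, ?_⟩))
      exact reach_mono (Finset.filter_subset _ F) hu

/-- **The inside part carries the cluster**: `x ↝_{B ∪ in(F)} v ↔ x ↝_{B ∪ F} v`. -/
theorem reach_inF_iff (B F : Finset (Sym2 V)) (x v : V) :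
    (fromEdgeSet ((↑B : Set (Sym2 V)) ∪ ↑(F.filter fun e => ∃ w ∈ e,
        (fromEdgeSet ((↑B : Set (Sym2 V)) ∪ ↑F)).Reachable x w))).Reachable x v ↔
      (fromEdgeSet ((↑B : Set (Sym2 V)) ∪ ↑F)).Reachable x v := by
  refine ⟨fun h => reach_mono (Finset.filter_subset _ F) h, fun h => ?_⟩
  obtain ⟨p⟩ := h
  exact reach_inF_walk p (Reachable.refl x)

omit [Fintype V] in
/-- Along a walk in `B ∪ (I ∪ O)` from a vertex reachable inside `B ∪ I`, if `O` avoids the vertices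
reachable inside `B ∪ I` then every vertex is reachable inside `B ∪ I` (edges of `O` are never usable). -/
theorem reach_union_walk {B I O : Finset (Sym2 V)} {x : V}
    (hO : ∀ e ∈ O, ∀ w ∈ e, ¬ (fromEdgeSet ((↑B : Set (Sym2 V)) ∪ ↑I)).Reachable x w) :
    ∀ {u v : V} (_ : (fromEdgeSet ((↑B : Set (Sym2 V)) ∪ ↑(I ∪ O))).Walk u v),
      (fromEdgeSet ((↑B : Set (Sym2 V)) ∪ ↑I)).Reachable x u →
      (fromEdgeSet ((↑B : Set (Sym2 V)) ∪ ↑I)).Reachable x v := by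
  intro u v p
  induction p with
  | nil => exact id
  | @cons u w _ hadj _ ih =>
    intro hu
    obtain ⟨hmem, -⟩ := (fromEdgeSet_adj _).1 hadj
    have hstep : s(u, w) ∈ B ∨ s(u, w) ∈ I := by
      rcases hmem with h | h
      · exact Or.inl (Finset.mem_coe.1 h)
      · rcases Finset.mem_union.1 (Finset.mem_coe.1 h) with h' | h'
        · exact Or.inr h'
        · exact absurd hu (hO _ h' u (Sym2.mem_mk_left u w))
    exact ih (reach_step hstep (Sym2.mem_mk_left u w) (Sym2.mem_mk_right u w) hu)

omit [Fintype V] in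
/-- **Gluing an outside part does not change the cluster**: if `O` avoids the vertices reachable inside
`B ∪ I`, then `x ↝_{B ∪ (I ∪ O)} v ↔ x ↝_{B ∪ I} v`. -/
theorem reach_union_iff {B I O : Finset (Sym2 V)} {x : V}
    (hO : ∀ e ∈ O, ∀ w ∈ e, ¬ (fromEdgeSet ((↑B : Set (Sym2 V)) ∪ ↑I)).Reachable x w) (v : V) :
    (fromEdgeSet ((↑B : Set (Sym2 V)) ∪ ↑(I ∪ O))).Reachable x v ↔
      (fromEdgeSet ((↑B : Set (Sym2 V)) ∪ ↑I)).Reachable x v := by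
  refine ⟨fun h => ?_, fun h => reach_mono Finset.subset_union_left h⟩
  obtain ⟨p⟩ := h
  exact reach_union_walk hO p (Reachable.refl x)

/-! ### Degrees -/

omit [Fintype V] in
/-- Degrees add over a disjoint union of edge sets. -/
theorem deg_union {I O : Finset (Sym2 V)} (h : Disjoint I O) (v : V) :
    #((I ∪ O).filter (v ∈ ·)) = #(I.filter (v ∈ ·)) + #(O.filter (v ∈ ·)) := by
  rw [Finset.filter_union, Finset.card_union_of_disjoint (Finset.disjoint_filter_filter h)]

omit [Fintype V] in
/-- An edge set none of whose edges contains `v` has degree `0` at `v`. -/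
theorem deg_eq_zero {O : Finset (Sym2 V)} {v : V} (h : ∀ e ∈ O, v ∉ e) : #(O.filter (v ∈ ·)) = 0 := by
  rw [Finset.card_eq_zero, Finset.filter_eq_empty_iff]
  exact fun e he hv => h e he hv

omit [Fintype V] in
/-- If every edge of `I` has an endpoint reachable inside `B ∪ I`, then a vertex NOT reachable inside `B ∪ I`
has `I`-degree `0`. -/
theorem deg_eq_zero_of_closed {B I : Finset (Sym2 V)} {x v : V}
    (hI : ∀ e ∈ I, ∃ w ∈ e, (fromEdgeSet ((↑B : Set (Sym2 V)) ∪ ↑I)).Reachable x w)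
    (hv : ¬ (fromEdgeSet ((↑B : Set (Sym2 V)) ∪ ↑I)).Reachable x v) : #(I.filter (v ∈ ·)) = 0 := by
  refine deg_eq_zero fun e he hve => hv ?_
  obtain ⟨w, hw, hrw⟩ := hI e he
  exact reach_step (Or.inr he) hw hve hrw

omit [Fintype V] in
/-- If `O` avoids the vertices reachable inside `B ∪ I`, a reachable vertex has `O`-degree `0`. -/
theorem deg_eq_zero_of_avoid {B I O : Finset (Sym2 V)} {x v : V}
    (hO : ∀ e ∈ O, ∀ w ∈ e, ¬ (fromEdgeSet ((↑B : Set (Sym2 V)) ∪ ↑I)).Reachable x w)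
    (hv : (fromEdgeSet ((↑B : Set (Sym2 V)) ∪ ↑I)).Reachable x v) : #(O.filter (v ∈ ·)) = 0 :=
  deg_eq_zero fun e he hve => hO e he v hve hv

/-- A `T`-join of a pair joins its pair (handshake inside the component of `x`,
`exists_reachable_odd_of_odd`): for `F ∈ tJoins G ω {x, y}`, `x ↝_F y`, hence also inside `B ∪ F`. -/
theorem reach_of_mem_tJoins_pair (G : SimpleGraph V) [DecidableRel G.Adj] {ω : Set (Sym2 V)} {x y : V}
    (B : Finset (Sym2 V)) {F : Finset (Sym2 V)} (hF : F ∈ tJoins G ω {x, y}) :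
    (fromEdgeSet ((↑B : Set (Sym2 V)) ∪ ↑F)).Reachable x y := by
  by_cases hxy : x = y
  · subst hxy; exact Reachable.refl _
  obtain ⟨hFG, -, hpar⟩ := (mem_tJoins G).1 hF
  have hFE : ∀ e ∈ F, ¬ e.IsDiag := fun e he =>
    G.not_isDiag_of_mem_edgeSet (mem_edgeFinset.1 (hFG he))
  have hx : Odd (edgeDeg F x) := (hpar x).2 (by simp)
  obtain ⟨w, hw, hreach, hwodd⟩ := exists_reachable_odd_of_odd F hFE hx
  have hw' : w ∈ ({x, y} : Finset V) := (hpar w).1 hwodd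
  rw [Finset.mem_insert, Finset.mem_singleton] at hw'
  rcases hw' with rfl | rfl
  · exact absurd rfl hw
  · exact hreach.mono (fromEdgeSet_mono Set.subset_union_right)


/-! ### The fibre decomposition relative to a base edge set `B` and a root `x`

Notation in the docstrings: `R_F v :⟺ x ↝_{B ∪ F} v`; `in(F) = {e ∈ F : ∃ w ∈ e, R_F w}`; the index set of
inside parts `Idx(S) = {I ∈ 𝒯(∅) : in(I) = I ∧ ∀ s ∈ S, ¬ R_I s}`; the outside `T`-joins
`Out_A(I) = tJoins G {e : ∀ w ∈ e, ¬ R_I w} A`. -/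

section Fibre

variable (G : SimpleGraph V) [DecidableRel G.Adj] (B : Finset (Sym2 V)) (x : V)

/-- Every edge of `in(F)` has all its endpoints reachable (closure of the cluster under `F`-edges). -/
theorem inF_closed {F : Finset (Sym2 V)} {e : Sym2 V}
    (he : e ∈ F.filter fun e => ∃ w ∈ e, (fromEdgeSet ((↑B : Set (Sym2 V)) ∪ ↑F)).Reachable x w)
    {v : V} (hv : v ∈ e) : (fromEdgeSet ((↑B : Set (Sym2 V)) ∪ ↑F)).Reachable x v := by
  obtain ⟨heF, w, hw, hrw⟩ := Finset.mem_filter.1 he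
  exact reach_step (Or.inr heF) hw hv hrw

/-- **`F ↦ in(F)` lands in the index set**: for `F ∈ 𝒯(A)` with `A ⊆ S` and `S` off the cluster of `F`,
`in(F)` is an even subgraph, glued to its own cluster, with `S` off that cluster. -/
theorem inF_mem_idx {A S : Finset V} (hAS : A ⊆ S) {F : Finset (Sym2 V)} (hF : F ∈ tJoins G Set.univ A)
    (hS : ∀ s ∈ S, ¬ (fromEdgeSet ((↑B : Set (Sym2 V)) ∪ ↑F)).Reachable x s) :
    (F.filter fun e => ∃ w ∈ e, (fromEdgeSet ((↑B : Set (Sym2 V)) ∪ ↑F)).Reachable x w) ∈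
      (tJoins G Set.univ (∅ : Finset V)).filter fun (I : Finset (Sym2 V)) =>
        (I.filter fun e => ∃ w ∈ e, (fromEdgeSet ((↑B : Set (Sym2 V)) ∪ ↑I)).Reachable x w) = I ∧
        ∀ s ∈ S, ¬ (fromEdgeSet ((↑B : Set (Sym2 V)) ∪ ↑I)).Reachable x s := by
  set I := F.filter fun e => ∃ w ∈ e, (fromEdgeSet ((↑B : Set (Sym2 V)) ∪ ↑F)).Reachable x w with hI
  obtain ⟨hFG, -, hpar⟩ := (mem_tJoins G).1 hF
  have hIF : I ⊆ F := Finset.filter_subset _ F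
  refine Finset.mem_filter.2 ⟨(mem_tJoins G).2 ⟨hIF.trans hFG, Set.subset_univ _, fun v => ?_⟩, ?_, fun s hs h => ?_⟩
  · -- degrees of `I` are even everywhere
    simp only [Finset.notMem_empty, iff_false]
    by_cases hv : (fromEdgeSet ((↑B : Set (Sym2 V)) ∪ ↑F)).Reachable x v
    · -- all `F`-edges at `v` are in `I`, and `v ∉ A`
      have hdeg : #(I.filter (v ∈ ·)) = #(F.filter (v ∈ ·)) := by
        congr 1; ext e
        simp only [hI, Finset.mem_filter]
        exact ⟨fun h => ⟨h.1.1, h.2⟩, fun h => ⟨⟨h.1, v, h.2, hv⟩, h.2⟩⟩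
      rw [hdeg, hpar v]
      exact fun hvA => hS v (hAS hvA) hv
    · rw [deg_eq_zero_of_closed (B := B) (x := x) (fun e he => ?_) (fun h => hv ((reach_inF_iff B F x v).1 h))]
      · exact Nat.not_odd_zero
      · obtain ⟨-, w, hw, hrw⟩ := Finset.mem_filter.1 he
        exact ⟨w, hw, (reach_inF_iff B F x w).2 hrw⟩
  · -- `in(I) = I`
    refine Finset.Subset.antisymm (Finset.filter_subset _ I) fun e he => Finset.mem_filter.2 ⟨he, ?_⟩
    obtain ⟨-, w, hw, hrw⟩ := Finset.mem_filter.1 he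
    exact ⟨w, hw, (reach_inF_iff B F x w).2 hrw⟩
  · exact hS s hs ((reach_inF_iff B F x s).1 h)

/-- **`F ↦ F ∖ in(F)` lands in the outside `T`-joins**: the edges of `F` off the cluster form a `T`-join of
the same source set among the edges avoiding the cluster of `in(F)` (`= ` the cluster of `F`). -/
theorem sdiff_mem_out {A S : Finset V} (hAS : A ⊆ S) {F : Finset (Sym2 V)} (hF : F ∈ tJoins G Set.univ A)
    (hS : ∀ s ∈ S, ¬ (fromEdgeSet ((↑B : Set (Sym2 V)) ∪ ↑F)).Reachable x s) :
    F \ (F.filter fun e => ∃ w ∈ e, (fromEdgeSet ((↑B : Set (Sym2 V)) ∪ ↑F)).Reachable x w) ∈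
      tJoins G {e | ∀ w ∈ e, ¬ (fromEdgeSet ((↑B : Set (Sym2 V)) ∪
        ↑(F.filter fun e => ∃ w ∈ e, (fromEdgeSet ((↑B : Set (Sym2 V)) ∪ ↑F)).Reachable x w))).Reachable x w} A := by
  set I := F.filter fun e => ∃ w ∈ e, (fromEdgeSet ((↑B : Set (Sym2 V)) ∪ ↑F)).Reachable x w with hI
  obtain ⟨hFG, -, hpar⟩ := (mem_tJoins G).1 hF
  have hIF : I ⊆ F := Finset.filter_subset _ F
  -- edges of `F ∖ I` avoid the cluster
  have havoid : ∀ e ∈ F \ I, ∀ w ∈ e, ¬ (fromEdgeSet ((↑B : Set (Sym2 V)) ∪ ↑F)).Reachable x w := by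
    intro e he w hw hrw
    rw [Finset.mem_sdiff] at he
    exact he.2 (Finset.mem_filter.2 ⟨he.1, w, hw, hrw⟩)
  refine (mem_tJoins G).2 ⟨Finset.sdiff_subset.trans hFG, fun e he w hw h => ?_, fun v => ?_⟩
  · exact havoid e (Finset.mem_coe.1 he) w hw ((reach_inF_iff B F x w).1 h)
  · have hsplit : #(F.filter (v ∈ ·)) = #(I.filter (v ∈ ·)) + #((F \ I).filter (v ∈ ·)) := by
      rw [← deg_union Finset.disjoint_sdiff, Finset.union_sdiff_of_subset hIF]
    by_cases hv : (fromEdgeSet ((↑B : Set (Sym2 V)) ∪ ↑F)).Reachable x v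
    · rw [deg_eq_zero fun e he hve => havoid e he v hve hv]
      simp only [Nat.not_odd_zero, false_iff]
      exact fun hvA => hS v (hAS hvA) hv
    · have h0 : #(I.filter (v ∈ ·)) = 0 := deg_eq_zero fun e he hve => hv (inF_closed B x he hve)
      rw [h0, zero_add] at hsplit
      rw [← hsplit]
      exact hpar v

/-- **`(I, O) ↦ I ∪ O` lands in the fibre over `I`**: for `I` in the index set and `O` an outside `T`-join
of `A ⊆ S`, `I ∪ O ∈ 𝒯(A)`, `S` is off the cluster of `I ∪ O`, and `in(I ∪ O) = I`. -/
theorem union_mem_fibre {A S : Finset V} (hAS : A ⊆ S) {I O : Finset (Sym2 V)}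
    (hI : I ∈ (tJoins G Set.univ (∅ : Finset V)).filter fun (I : Finset (Sym2 V)) =>
        (I.filter fun e => ∃ w ∈ e, (fromEdgeSet ((↑B : Set (Sym2 V)) ∪ ↑I)).Reachable x w) = I ∧
        ∀ s ∈ S, ¬ (fromEdgeSet ((↑B : Set (Sym2 V)) ∪ ↑I)).Reachable x s)
    (hO : O ∈ tJoins G {e | ∀ w ∈ e, ¬ (fromEdgeSet ((↑B : Set (Sym2 V)) ∪ ↑I)).Reachable x w} A) :
    (I ∪ O ∈ tJoins G Set.univ A ∧
      ∀ s ∈ S, ¬ (fromEdgeSet ((↑B : Set (Sym2 V)) ∪ ↑(I ∪ O))).Reachable x s) ∧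
    ((I ∪ O).filter fun e => ∃ w ∈ e, (fromEdgeSet ((↑B : Set (Sym2 V)) ∪ ↑(I ∪ O))).Reachable x w) = I := by
  obtain ⟨hI0, hIcl, hIS⟩ := Finset.mem_filter.1 hI
  obtain ⟨hIG, -, hIpar⟩ := (mem_tJoins G).1 hI0
  obtain ⟨hOG, hOω, hOpar⟩ := (mem_tJoins G).1 hO
  have havoid : ∀ e ∈ O, ∀ w ∈ e, ¬ (fromEdgeSet ((↑B : Set (Sym2 V)) ∪ ↑I)).Reachable x w :=
    fun e he w hw => hOω (Finset.mem_coe.2 he) w hw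
  have hIcl' : ∀ e ∈ I, ∃ w ∈ e, (fromEdgeSet ((↑B : Set (Sym2 V)) ∪ ↑I)).Reachable x w := by
    intro e he
    rw [← hIcl] at he
    exact (Finset.mem_filter.1 he).2
  have hdisj : Disjoint I O := by
    rw [Finset.disjoint_left]
    intro e heI heO
    obtain ⟨w, hw, hrw⟩ := hIcl' e heI
    exact havoid e heO w hw hrw
  have hreach := reach_union_iff (B := B) havoid
  refine ⟨⟨(mem_tJoins G).2 ⟨?_, Set.subset_univ _, fun v => ?_⟩, fun s hs h => hIS s hs ((hreach s).1 h)⟩, ?_⟩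
  · intro e he
    rcases Finset.mem_union.1 he with h | h
    · exact hIG h
    · exact hOG h
  · rw [deg_union hdisj]
    by_cases hv : (fromEdgeSet ((↑B : Set (Sym2 V)) ∪ ↑I)).Reachable x v
    · rw [deg_eq_zero_of_avoid havoid hv, add_zero]
      have heven : ¬ Odd #(I.filter (v ∈ ·)) := fun h => Finset.notMem_empty v ((hIpar v).1 h)
      simp only [heven, false_iff]
      exact fun hvA => hIS v (hAS hvA) hv
    · rw [deg_eq_zero_of_closed hIcl' hv, zero_add]
      exact hOpar v
  · rw [Finset.filter_union]
    have h1 : (I.filter fun e => ∃ w ∈ e, (fromEdgeSet ((↑B : Set (Sym2 V)) ∪ ↑(I ∪ O))).Reachable x w) = I := by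
      refine Finset.Subset.antisymm (Finset.filter_subset _ I) fun e he => Finset.mem_filter.2 ⟨he, ?_⟩
      obtain ⟨w, hw, hrw⟩ := hIcl' e he
      exact ⟨w, hw, (hreach w).2 hrw⟩
    have h2 : (O.filter fun e => ∃ w ∈ e, (fromEdgeSet ((↑B : Set (Sym2 V)) ∪ ↑(I ∪ O))).Reachable x w) = ∅ := by
      rw [Finset.filter_eq_empty_iff]
      rintro e he ⟨w, hw, hrw⟩
      exact havoid e he w hw ((hreach w).1 hrw)
    rw [h1, h2, Finset.union_empty]

/-- **The fibre identity.**  For sources `A ⊆ S` required to lie off the cluster, summing `g` over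
`{F ∈ 𝒯(A) : S off C_F}` equals summing `g(I ∪ O)` over inside parts `I ∈ Idx(S)` and outside `T`-joins
`O ∈ Out_A(I)` — the same index set `Idx(S)` for every `A`. -/
theorem fibre_identity {A S : Finset V} (hAS : A ⊆ S) (g : Finset (Sym2 V) → ℝ) :
    ∑ F ∈ (tJoins G Set.univ A).filter
        (fun (F : Finset (Sym2 V)) => ∀ s ∈ S, ¬ (fromEdgeSet ((↑B : Set (Sym2 V)) ∪ ↑F)).Reachable x s), g F =
    ∑ I ∈ (tJoins G Set.univ (∅ : Finset V)).filter (fun (I : Finset (Sym2 V)) =>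
        (I.filter fun e => ∃ w ∈ e, (fromEdgeSet ((↑B : Set (Sym2 V)) ∪ ↑I)).Reachable x w) = I ∧
        ∀ s ∈ S, ¬ (fromEdgeSet ((↑B : Set (Sym2 V)) ∪ ↑I)).Reachable x s),
      ∑ O ∈ tJoins G {e | ∀ w ∈ e, ¬ (fromEdgeSet ((↑B : Set (Sym2 V)) ∪ ↑I)).Reachable x w} A,
        g (I ∪ O) := by
  rw [← Finset.sum_fiberwise_of_maps_to
    (g := fun F : Finset (Sym2 V) => F.filter fun e => ∃ w ∈ e,
      (fromEdgeSet ((↑B : Set (Sym2 V)) ∪ ↑F)).Reachable x w)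
    (fun F hF => ?maps)]
  case maps =>
    obtain ⟨hF, hS⟩ := Finset.mem_filter.1 hF
    exact inF_mem_idx G B x hAS hF hS
  refine Finset.sum_congr rfl fun I hI => ?_
  -- the fibre over `I` is in bijection with `Out_A(I)` via `F ↦ F ∖ I`, `O ↦ I ∪ O`
  refine Finset.sum_bij' (fun F _ => F \ I) (fun O _ => I ∪ O) ?_ ?_ ?_ ?_ ?_
  · intro F hF
    obtain ⟨hF, hFI⟩ := Finset.mem_filter.1 hF
    obtain ⟨hF, hS⟩ := Finset.mem_filter.1 hF
    have h := sdiff_mem_out G B x hAS hF hS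
    rw [hFI] at h
    exact h
  · intro O hO
    obtain ⟨⟨h1, h2⟩, h3⟩ := union_mem_fibre G B x hAS hI hO
    exact Finset.mem_filter.2 ⟨Finset.mem_filter.2 ⟨h1, h2⟩, h3⟩
  · intro F hF
    obtain ⟨-, hFI⟩ := Finset.mem_filter.1 hF
    have hIF : I ⊆ F := by rw [← hFI]; exact Finset.filter_subset _ F
    exact Finset.union_sdiff_of_subset hIF
  · intro O hO
    obtain ⟨-, hIcl, -⟩ := Finset.mem_filter.1 hI
    have hIcl' : ∀ e ∈ I, ∃ w ∈ e, (fromEdgeSet ((↑B : Set (Sym2 V)) ∪ ↑I)).Reachable x w := by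
      intro e he
      rw [← hIcl] at he
      exact (Finset.mem_filter.1 he).2
    obtain ⟨-, hOω, -⟩ := (mem_tJoins G).1 hO
    have hdisj : Disjoint I O := by
      rw [Finset.disjoint_left]
      intro e heI heO
      obtain ⟨w, hw, hrw⟩ := hIcl' e heI
      exact hOω (Finset.mem_coe.2 heO) w hw hrw
    exact Finset.union_sdiff_cancel_left hdisj
  · intro F hF
    obtain ⟨-, hFI⟩ := Finset.mem_filter.1 hF
    have hIF : I ⊆ F := by rw [← hFI]; exact Finset.filter_subset _ F
    rw [Finset.union_sdiff_of_subset hIF]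

end Fibre

end StubUnionShadowIdentity

open StubUnionShadowIdentity in
/-- **Registered aux stub `stub_unionShadowFibre`** (crux stmt-CriticalPhenomena-14625, line `union-shadow-exact`):
the fibre identity relative to a base `B` rooted at `x` — for sources `A ⊆ S` required off the cluster,
`Σ_{F ∈ 𝒯(A), S off C_F} g(F) = Σ_{I ∈ Idx(S)} Σ_{O ∈ 𝒯_{off C_I}(A)} g(I ∪ O)`. -/
theorem stub_unionShadowFibre :
    ∀ (V : Type) [Fintype V] [DecidableEq V] (G : SimpleGraph V) [DecidableRel G.Adj] (B : Finset (Sym2 V))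
      (x : V) (A S : Finset V), A ⊆ S → ∀ g : Finset (Sym2 V) → ℝ,
      ∑ F ∈ (tJoins G Set.univ A).filter
          (fun (F : Finset (Sym2 V)) => ∀ s ∈ S, ¬ (SimpleGraph.fromEdgeSet ((↑B : Set (Sym2 V)) ∪ ↑F)).Reachable x s), g F =
      ∑ I ∈ (tJoins G Set.univ (∅ : Finset V)).filter (fun (I : Finset (Sym2 V)) =>
          (I.filter fun e => ∃ w ∈ e, (SimpleGraph.fromEdgeSet ((↑B : Set (Sym2 V)) ∪ ↑I)).Reachable x w) = I ∧
          ∀ s ∈ S, ¬ (SimpleGraph.fromEdgeSet ((↑B : Set (Sym2 V)) ∪ ↑I)).Reachable x s),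
        ∑ O ∈ tJoins G {e | ∀ w ∈ e, ¬ (SimpleGraph.fromEdgeSet ((↑B : Set (Sym2 V)) ∪ ↑I)).Reachable x w} A,
          g (I ∪ O) :=
  fun _ _ _ G _ B x _ _ hAS g => fibre_identity G B x hAS g

end Summit.CriticalPhenomena.Ising3DConformalLimit.Theorems

end
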